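import Literature.AnabelianGeometry.SemiGraphs.TemperedPiCoverMaps

/-!
# Fullness of the fibre functor, I: the transported value is well defined ([SemiAnbd] Prop. 3.6 (ii))

Sequel to `TemperedPiCoverMaps.lean`.  Given a `π₁^temp(𝒢)`-equivariant map `m : T_{v₀} → T'_{v₀}`,
a point `x ∈ T_v` is reached as `x = liftι_{x₁,N}(u)` for "admissible data" `(x₁, N, u)`
(`x₁ ∈ T_{v₀}` in the component of `x`, a level `N`, a point `u` of `𝒢_{∞,N}` over `v`); the
candidate image `liftι_{m x₁,N}(u) ∈ T'_v` does not depend on the data (`value_indep`): raise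
levels along `coverMap`, move the base point by `τ ∈ G_N` (`exists_actAt_eq`, `aut_comp_liftι`,
`map_actAt`), and compare points of one fibre by the key step `liftι_map_eq_of_liftι_eq`.
-/

namespace Literature.AnabelianGeometry.SemiGraphs

namespace ProfiniteSemiGraph

open CategoryTheory

universe u

variable {𝒢 : ProfiniteSemiGraph.{u}}

namespace GaloisLevelData

variable (D : GaloisLevelData 𝒢) (h𝒢 : 𝒢.IsCountable) (T T' : CovObj 𝒢)
  (lev : (T.SV D.v₀).obj.V → ℕ)
  (hlev : ∀ (t : (T.SV D.v₀).obj.V) (n : ℕ), lev t ≤ n →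
    (D.S n).Splits (T.component (Sum.inl ⟨D.v₀, t⟩)))
  (lev' : (T'.SV D.v₀).obj.V → ℕ)
  (hlev' : ∀ (t : (T'.SV D.v₀).obj.V) (n : ℕ), lev' t ≤ n →
    (D.S n).Splits (T'.component (Sum.inl ⟨D.v₀, t⟩)))
  (m : D.fibreObj h𝒢 T lev hlev ⟶ D.fibreObj h𝒢 T' lev' hlev')

/-- `liftι` only depends on the base point (not on the splitting proof); transport along an
equality of base points. [cite: MochizukiSemiAnbd2006, Prop 3.6(ii) p.38] -/
theorem liftι_congr {X : CovObj 𝒢} {t t' : (X.SV D.v₀).obj.V} (e : t = t') (n : ℕ)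
    (hs : (D.S n).Splits (X.component (Sum.inl ⟨D.v₀, t⟩)))
    (hs' : (D.S n).Splits (X.component (Sum.inl ⟨D.v₀, t'⟩))) :
    D.liftι h𝒢 X t n hs = D.liftι h𝒢 X t' n hs' := by
  subst e
  rfl

/-- The candidate value `liftι_{m x₁, N}(u)` attached to data `(x₁, N, u)` over `v`.
[cite: MochizukiSemiAnbd2006, Prop 3.6(ii) p.38] -/
noncomputable def value (x₁ : (T.SV D.v₀).obj.V) (N : ℕ) (h2 : lev' (m.hom.hom x₁) ≤ N)
    {v : 𝒢.graph.Vertex} (u : (D.S N).FibV (Sum.inl (D.W N)) v) : (T'.SV v).obj.V :=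
  ((D.liftι h𝒢 T' (m.hom.hom x₁) N (hlev' _ N h2)).fV v).hom.hom u

/-- Step (3): same base point and level, two points of one fibre with the same image.
[cite: MochizukiSemiAnbd2006, Prop 3.6(ii) p.38] -/
theorem value_eq_of_same (x₁ : (T.SV D.v₀).obj.V) (N : ℕ) (h1 : lev x₁ ≤ N)
    (h2 : lev' (m.hom.hom x₁) ≤ N) {v : 𝒢.graph.Vertex} (u u' : (D.S N).FibV (Sum.inl (D.W N)) v)
    (h : ((D.liftι h𝒢 T x₁ N (hlev x₁ N h1)).fV v).hom.hom u =
      ((D.liftι h𝒢 T x₁ N (hlev x₁ N h1)).fV v).hom.hom u') :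
    D.value h𝒢 T T' lev hlev lev' hlev' m x₁ N h2 u = D.value h𝒢 T T' lev hlev lev' hlev' m x₁ N h2 u' :=
  D.liftι_map_eq_of_liftι_eq h𝒢 T x₁ N T' lev hlev lev' hlev' m h1 h2 u u' h

/-- Step (1): raising the level along `coverMap` does not change image or value.
[cite: MochizukiSemiAnbd2006, Prop 3.6(ii) p.38] -/
theorem value_coverMap (x₁ : (T.SV D.v₀).obj.V) {N N' : ℕ} (hN : N ≤ N')
    (h2 : lev' (m.hom.hom x₁) ≤ N) {v : 𝒢.graph.Vertex} (u' : (D.S N').FibV (Sum.inl (D.W N')) v) :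
    D.value h𝒢 T T' lev hlev lev' hlev' m x₁ N' (h2.trans hN) u' =
      D.value h𝒢 T T' lev hlev lev' hlev' m x₁ N h2 (((D.coverMap h𝒢 hN).fV v).hom.hom u') := by
  unfold value
  rw [← D.coverMap_liftι h𝒢 T' (m.hom.hom x₁) hN (hlev' _ N h2) (hlev' _ N' (h2.trans hN))]
  rfl

/-- Image under `liftι` after raising the level. [cite: MochizukiSemiAnbd2006, Prop 3.6(ii) p.38] -/
theorem liftι_coverMap_apply (x₁ : (T.SV D.v₀).obj.V) {N N' : ℕ} (hN : N ≤ N') (h1 : lev x₁ ≤ N)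
    {v : 𝒢.graph.Vertex} (u' : (D.S N').FibV (Sum.inl (D.W N')) v) :
    ((D.liftι h𝒢 T x₁ N' (hlev x₁ N' (h1.trans hN))).fV v).hom.hom u' =
      ((D.liftι h𝒢 T x₁ N (hlev x₁ N h1)).fV v).hom.hom (((D.coverMap h𝒢 hN).fV v).hom.hom u') := by
  rw [← D.coverMap_liftι h𝒢 T x₁ hN (hlev x₁ N h1) (hlev x₁ N' (h1.trans hN))]
  rfl

/-- Step (2): moving the base point by `τ ∈ G_N` (`x₂ = τ · x₁`): images and values of `u` for
`x₂` are those of `τ⁻¹ u` for `x₁`. [cite: MochizukiSemiAnbd2006, Prop 3.6(ii) p.38] -/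
theorem liftι_actAt_apply (x₁ : (T.SV D.v₀).obj.V) (N : ℕ) (h1 : lev x₁ ≤ N) (τ : D.Gal h𝒢 N)
    (hs₂ : (D.S N).Splits (T.component (Sum.inl ⟨D.v₀, D.actAt h𝒢 T x₁ N (hlev x₁ N h1) τ⟩)))
    {v : 𝒢.graph.Vertex} (u : (D.S N).FibV (Sum.inl (D.W N)) v) :
    ((D.liftι h𝒢 T (D.actAt h𝒢 T x₁ N (hlev x₁ N h1) τ) N hs₂).fV v).hom.hom u =
      ((D.liftι h𝒢 T x₁ N (hlev x₁ N h1)).fV v).hom.hom (((τ⁻¹ : D.Gal h𝒢 N).hom.fV v).hom.hom u) := by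
  have key := D.aut_comp_liftι h𝒢 T x₁ N (hlev x₁ N h1) τ⁻¹
  rw [inv_inv] at key
  rw [D.liftι_congr h𝒢 rfl N hs₂ (D.splits_actAt h𝒢 T x₁ N (hlev x₁ N h1) τ), ← key]
  rfl

/-- Step (2) for values. [cite: MochizukiSemiAnbd2006, Prop 3.6(ii) p.38] -/
theorem value_actAt (x₁ : (T.SV D.v₀).obj.V) (N : ℕ) (h1 : lev x₁ ≤ N)
    (h2 : lev' (m.hom.hom x₁) ≤ N) (τ : D.Gal h𝒢 N)
    (h2₂ : lev' (m.hom.hom (D.actAt h𝒢 T x₁ N (hlev x₁ N h1) τ)) ≤ N)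
    {v : 𝒢.graph.Vertex} (u : (D.S N).FibV (Sum.inl (D.W N)) v) :
    D.value h𝒢 T T' lev hlev lev' hlev' m (D.actAt h𝒢 T x₁ N (hlev x₁ N h1) τ) N h2₂ u =
      D.value h𝒢 T T' lev hlev lev' hlev' m x₁ N h2 (((τ⁻¹ : D.Gal h𝒢 N).hom.fV v).hom.hom u) := by
  unfold value
  have e := D.map_actAt h𝒢 T T' lev hlev lev' hlev' m x₁ N h1 h2 τ
  have key := D.aut_comp_liftι h𝒢 T' (m.hom.hom x₁) N (hlev' _ N h2) τ⁻¹
  rw [inv_inv] at key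
  rw [D.liftι_congr h𝒢 e N (hlev' _ N h2₂) (D.splits_actAt h𝒢 T' _ N (hlev' _ N h2) τ), ← key]
  rfl

/-- **The value is independent of the admissible data.** [cite: MochizukiSemiAnbd2006, Prop 3.6(ii) p.38] -/
theorem value_indep {v : 𝒢.graph.Vertex} (x : (T.SV v).obj.V)
    (x₁ : (T.SV D.v₀).obj.V) (N₁ : ℕ) (h1₁ : lev x₁ ≤ N₁) (h2₁ : lev' (m.hom.hom x₁) ≤ N₁)
    (u₁ : (D.S N₁).FibV (Sum.inl (D.W N₁)) v)
    (hu₁ : ((D.liftι h𝒢 T x₁ N₁ (hlev x₁ N₁ h1₁)).fV v).hom.hom u₁ = x)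
    (x₂ : (T.SV D.v₀).obj.V) (N₂ : ℕ) (h1₂ : lev x₂ ≤ N₂) (h2₂ : lev' (m.hom.hom x₂) ≤ N₂)
    (u₂ : (D.S N₂).FibV (Sum.inl (D.W N₂)) v)
    (hu₂ : ((D.liftι h𝒢 T x₂ N₂ (hlev x₂ N₂ h1₂)).fV v).hom.hom u₂ = x) :
    D.value h𝒢 T T' lev hlev lev' hlev' m x₁ N₁ h2₁ u₁ =
      D.value h𝒢 T T' lev hlev lev' hlev' m x₂ N₂ h2₂ u₂ := by
  -- (1) raise both to the common level `N`
  obtain ⟨w₁, hw₁⟩ := D.coverMap_fV_surjective h𝒢 (le_max_left N₁ N₂) v u₁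
  obtain ⟨w₂, hw₂⟩ := D.coverMap_fV_surjective h𝒢 (le_max_right N₁ N₂) v u₂
  rw [← hw₁, ← hw₂, ← D.value_coverMap, ← D.value_coverMap]
  rw [← hw₁, ← D.liftι_coverMap_apply h𝒢 T lev hlev x₁ (le_max_left N₁ N₂) h1₁] at hu₁
  rw [← hw₂, ← D.liftι_coverMap_apply h𝒢 T lev hlev x₂ (le_max_right N₁ N₂) h1₂] at hu₂
  -- (2) `x₂ = τ · x₁` at level `N`
  have hcomp : T.SameComponent (Sum.inl ⟨D.v₀, x₁⟩) (Sum.inl ⟨D.v₀, x₂⟩) := by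
    have c₁ := (((D.liftAt h𝒢 T x₁ (max N₁ N₂) (hlev x₁ _ (h1₁.trans (le_max_left N₁ N₂)))).fV v).hom.hom w₁).2
    have c₂ := (((D.liftAt h𝒢 T x₂ (max N₁ N₂) (hlev x₂ _ (h1₂.trans (le_max_right N₁ N₂)))).fV v).hom.hom w₂).2
    have e₁ : (((D.liftAt h𝒢 T x₁ (max N₁ N₂) (hlev x₁ _ (h1₁.trans (le_max_left N₁ N₂)))).fV v).hom.hom w₁).1 = x := hu₁
    have e₂ : (((D.liftAt h𝒢 T x₂ (max N₁ N₂) (hlev x₂ _ (h1₂.trans (le_max_right N₁ N₂)))).fV v).hom.hom w₂).1 = x := hu₂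
    rw [e₁] at c₁
    rw [e₂] at c₂
    exact Relation.EqvGen.trans _ _ _ c₁ (Relation.EqvGen.symm _ _ c₂)
  obtain ⟨τ, hτ⟩ := D.exists_actAt_eq h𝒢 T x₁ x₂ (max N₁ N₂)
    (hlev x₁ _ (h1₁.trans (le_max_left N₁ N₂))) hcomp
  subst hτ
  rw [D.value_actAt h𝒢 T T' lev hlev lev' hlev' m x₁ (max N₁ N₂) (h1₁.trans (le_max_left N₁ N₂))
    (h2₁.trans (le_max_left N₁ N₂)) τ]
  rw [D.liftι_actAt_apply h𝒢 T lev hlev x₁ (max N₁ N₂) (h1₁.trans (le_max_left N₁ N₂)) τ] at hu₂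
  -- (3) same base point and level
  exact D.value_eq_of_same h𝒢 T T' lev hlev lev' hlev' m x₁ (max N₁ N₂)
    (h1₁.trans (le_max_left N₁ N₂)) (h2₁.trans (le_max_left N₁ N₂)) w₁ _ (hu₁.trans hu₂.symm)

end GaloisLevelData

end ProfiniteSemiGraph

end Literature.AnabelianGeometry.SemiGraphs
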